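import Summits.CriticalPhenomena.PercolationContinuityZ3.Theorems.PercNearOneGluingNoHeavyLowerTailKnQuestion8CoefficientwiseCoreClassClusters
import HarnessLib

/-!
# The vertex-anchored linear row VREM and its reduction to SOURCE-EDGE DELETION MONOTONICITY — prim-lf-2 gen 67

Support file (`--supports stmt-CriticalPhenomena-4575`, closed), prover `prim-lf-2` (gen 67).  No definitions, no named facts, no sorries; standard axioms.
Memo `prim-lf-2/CW-DELETION-gen67.md` §0(vi), §5.

Setting: finite multigraph `ends : ι → Sym2 V`, edge set `E`, root `x`, SOURCE VERTEX `a`, target set `W`, `C_v(s) = openCluster (ends '' s) v`, and the linear row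
`VREM_E(x, a, W)[g] := Σ_{s ⊆ E : a ∈ C_x(s), ∀ w∈W ¬(w ∈ C_x s ∧ w ∈ C_x(E∖s))} (g(C_x s) − g(C_x(E∖s)))`
— for `a ∈ W` this is half the POINT ROW `NC*_E(x,W)[1_a, g]` of CONJECTURE NC* (prim-lf-2 gens 32–44, 63), and for a root edge `e = {x,a}` it contains gen 66's REM
(`VREM(a, W) = REM(e, W ∪ {a})`).  CONJECTURE (VD) (prim-lf-2 gen 67): `VREM_{E.erase h} ≤ VREM_E` for every edge `h` at `a` (exact census: all rooted connected simple graphs on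
≤ 6 vertices, all `a, W, h`: 173 910 cases; 7 vertices with ≤ 12 edges: 2 880 486 cases; random graphs up to 10 vertices; the LOBE family: 0 failures; the contraction analogue fails at n = 7).
* `Coefficientwise.vrem_eq_zero_of_isolated` — **BASE CASE**: if no edge of `E` contains `a ≠ x`, the row is an empty sum.
* `Coefficientwise.vrem_nonneg_of_sourceDeletion` — **REDUCTION**: (VD) for all `E` and all edges `h ∋ a` implies `VREM_E ≥ 0` for every `E` (delete the star of `a`).
[cite: KozmaNitzan2024, Questions 8–9 (§5.5 p. 36) (context: the Question-8 pocket covariance programme)]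
-/

namespace Summit.CriticalPhenomena.PercolationContinuityZ3.Theorems

open Finset Literature.Probability.Percolation

namespace Coefficientwise

variable {ι V : Type*} [DecidableEq ι] (ends : ι → Sym2 V)

open Classical in
/-- **Base case: `a` isolated.**  If `a ≠ x` meets no edge of `E` then `a ∉ C_x(s)` for every `s ⊆ E`, so the row `VREM_E(x,a,W)[g]` is the empty sum.
[cite: KozmaNitzan2024, §5.5 (context only; folklore)] -/
theorem vrem_eq_zero_of_isolated (E : Finset ι) {x a : V} (hax : a ≠ x) (hiso : ∀ h ∈ E, a ∉ ends h) (W : Set V) (g : Set V → ℝ) :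
    ∑ s ∈ E.powerset.filter (fun s : Finset ι => a ∈ openCluster (ends '' (↑s : Set ι)) x ∧
          ∀ w ∈ W, ¬ (w ∈ openCluster (ends '' (↑s : Set ι)) x ∧ w ∈ openCluster (ends '' (↑(E \ s) : Set ι)) x)),
      (g (openCluster (ends '' (↑s : Set ι)) x) - g (openCluster (ends '' (↑(E \ s) : Set ι)) x)) = 0 := by
  refine Finset.sum_eq_zero fun s hs => ?_
  exfalso
  have hsE : s ⊆ E := Finset.mem_powerset.mp (Finset.mem_filter.mp hs).1
  have ha : a ∈ openCluster (ends '' (↑s : Set ι)) x := (Finset.mem_filter.mp hs).2.1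
  exact not_mem_openCluster_of_no_edge_at ends s hax.symm (fun i hi => hiso i (hsE hi)) ha

open Classical in
/-- **REDUCTION: source-edge deletion monotonicity implies the row inequality.**  Fix `ends`, `x`, a source vertex `a ≠ x`, `W` and `g`.  Suppose (VD): for every edge set `E`
and every `h ∈ E` with `a ∈ ends h`, `VREM_{E.erase h}(x,a,W)[g] ≤ VREM_E(x,a,W)[g]`.  Then `0 ≤ VREM_E(x,a,W)[g]` for every `E` (induction on the number of edges at `a`;
base `vrem_eq_zero_of_isolated`).  [cite: KozmaNitzan2024, Questions 8–9 (§5.5 p. 36) (context)] -/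
theorem vrem_nonneg_of_sourceDeletion {x a : V} (hax : a ≠ x) (W : Set V) (g : Set V → ℝ)
    (hVD : ∀ (E : Finset ι) (h : ι), h ∈ E → a ∈ ends h →
      ∑ s ∈ (E.erase h).powerset.filter (fun s : Finset ι => a ∈ openCluster (ends '' (↑s : Set ι)) x ∧
            ∀ w ∈ W, ¬ (w ∈ openCluster (ends '' (↑s : Set ι)) x ∧ w ∈ openCluster (ends '' (↑((E.erase h) \ s) : Set ι)) x)),
          (g (openCluster (ends '' (↑s : Set ι)) x) - g (openCluster (ends '' (↑((E.erase h) \ s) : Set ι)) x)) ≤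
      ∑ s ∈ E.powerset.filter (fun s : Finset ι => a ∈ openCluster (ends '' (↑s : Set ι)) x ∧
            ∀ w ∈ W, ¬ (w ∈ openCluster (ends '' (↑s : Set ι)) x ∧ w ∈ openCluster (ends '' (↑(E \ s) : Set ι)) x)),
          (g (openCluster (ends '' (↑s : Set ι)) x) - g (openCluster (ends '' (↑(E \ s) : Set ι)) x)))
    (E : Finset ι) :
    0 ≤ ∑ s ∈ E.powerset.filter (fun s : Finset ι => a ∈ openCluster (ends '' (↑s : Set ι)) x ∧
          ∀ w ∈ W, ¬ (w ∈ openCluster (ends '' (↑s : Set ι)) x ∧ w ∈ openCluster (ends '' (↑(E \ s) : Set ι)) x)),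
      (g (openCluster (ends '' (↑s : Set ι)) x) - g (openCluster (ends '' (↑(E \ s) : Set ι)) x)) := by
  suffices hmain : ∀ (n : ℕ) (E : Finset ι), (E.filter (fun h : ι => a ∈ ends h)).card = n →
      0 ≤ ∑ s ∈ E.powerset.filter (fun s : Finset ι => a ∈ openCluster (ends '' (↑s : Set ι)) x ∧
          ∀ w ∈ W, ¬ (w ∈ openCluster (ends '' (↑s : Set ι)) x ∧ w ∈ openCluster (ends '' (↑(E \ s) : Set ι)) x)),
        (g (openCluster (ends '' (↑s : Set ι)) x) - g (openCluster (ends '' (↑(E \ s) : Set ι)) x)) from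
    hmain _ E rfl
  intro n
  induction n with
  | zero =>
    intro E hcard
    have hiso : ∀ h ∈ E, a ∉ ends h := by
      intro h hh hah
      have hmem : h ∈ E.filter (fun h : ι => a ∈ ends h) := Finset.mem_filter.mpr ⟨hh, hah⟩
      rw [Finset.card_eq_zero] at hcard
      rw [hcard] at hmem
      exact Finset.notMem_empty h hmem
    exact le_of_eq (vrem_eq_zero_of_isolated ends E hax hiso W g).symm
  | succ n ih =>
    intro E hcard
    obtain ⟨h, hh⟩ : (E.filter (fun h : ι => a ∈ ends h)).Nonempty := by
      rw [← Finset.card_pos, hcard]; exact Nat.succ_pos n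
    have hhE : h ∈ E := (Finset.mem_filter.mp hh).1
    have hah : a ∈ ends h := (Finset.mem_filter.mp hh).2
    have hcard' : ((E.erase h).filter (fun h' : ι => a ∈ ends h')).card = n := by
      have hEq : (E.erase h).filter (fun h' : ι => a ∈ ends h') = (E.filter (fun h' : ι => a ∈ ends h')).erase h := by
        rw [Finset.filter_erase]
      rw [hEq, Finset.card_erase_of_mem hh, hcard]
      rfl
    exact le_trans (ih (E.erase h) hcard') (hVD E h hhE hah)

end Coefficientwise

end Summit.CriticalPhenomena.PercolationContinuityZ3.Theorems
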